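import Summits.QuantumFields.BalabanUV.T4Continuum.Support.NE3CovariantLineSumsL2Sharp
import Summits.QuantumFields.BalabanUV.T4Continuum.Support.ReplicationRightInverseBound
import HarnessLib

/-!
# T⁴ programme, node NE3, route (H♮) row C1 (file 5♯) — THE k-LEVEL COMB ERROR IN ℓ²(TORUS) WITHOUT THE BOX, AND WITHOUT THE EXTRA LINE:
# `√l2sq_N (ErrIter L (j+1) W Y) ≤ ρ^{j+1}·√l2sq_{tower L N (j+1)} Y` IN THE TOWER CLASS `LevelSmall` ALONE (`L ≥ 2`)

NE3 formalisation swarm `b2b-balaban-t4-ne3-formalise-*`, LEAF PROVER 04 (gen 6), the author lineage of C1.  File 4♯ (`NE3CovariantLineSumsL2Sharp`,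
this seat) replaced the box constant `C2sq` of the one-level comb defect by `100 080 016·d²·L`; in the LINEAR form used here,
`√l2sq_{N′} (Dstr L W Y) ≤ KS·a·√l2sq_{L·N′} Y` with the sqrt-free letter **`KS d L := 160 064·d·(d+1)·(d+4)·L³`** (`16(d+1)(d+4)L²·√(100080016·d²·L) ≤ KS`
since `L ≤ L²`).  THIS FILE re-runs C1 file 5's ℓ² tower (`NE3CovariantLineSumsL2Tower.sqrt_l2sq_ErrIter_le`, p224466) with `delta2 ↦ KS·x` and the level
sum `S2sum (j+1) x ↦ KS·radSum d L j x` (`ReplicationRightInverseBound.radSum`: `radSum j x = Σ_{i≤j} r_i`, the same inner-first recursion), and then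
DISCHARGES the level-sum line from the class: `LevelSmall d L j x ⇒ KS·radSum d L j x ≤ ρ∕2` for every `d ≥ 1`, `L ≥ 2` (`radSum ≤ (4∕3)·r_j`,
`twoLevelSmall·r_j ≤ 1`, and `(8∕3)·KS ≤ twoLevelSmall·ρ` — squared: `(64∕9)·KS² ≤ 65536²(d+1)⁴(d+4)⁴L^{d+10}`, true by `(d+1)(d+4) ≥ 4d` and `L^{d+4} ≥ 16`).
CONSEQUENCE: the hypothesis `hS : S2sum d L (j+1) x ≤ ρ∕2` displayed by H4-W (p232724), H4-W♯ (p234726), K6b-3 (p233987) and K6c-1a (p234580) — which is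
NOT implied by the class with the crude `C2sq` (`S2sum` up to ≈ 11.8 ≫ 0.25 at d = 4, L = 2) — disappears for every consumer that switches to this file's
END: **`sqrt_l2sq_ErrIter_le_of_levelSmall`** gives the comb error tower the SAME weight `ρ^{j+1}` as the straight tower, under `LevelSmall` alone.

CONTENT (all [folklore]; 0 sorry; 0 def — `KS` is written out):
§1 `sqrt_le_of_sq_le_sq`-type bookkeeping: `sqrt_C2S_le` (`√(100080016·d²·L) ≤ 10004·d·L`), **`sqrt_l2sq_Dstr_le_sharp`** (`≤ KS·a·√l2sq`);
§2 `radSum_zero'` ∕ `radSum_succ'` (rfl), **`sqrt_l2sq_ErrIter_le_sharp`** — the tower with the level sum `KS·radSum d L j x ≤ ρ∕2` as hypothesis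
   (C1 file 5's induction verbatim: Minkowski, `QbarIter = QstrIter + ErrIter`, `2·S′ ≤ ρ`);
§3 **`KS_radSum_le_half_rho`** (`2 ≤ L`, `LevelSmall d L j x`, `0 ≤ x` ⇒ `KS·radSum d L j x ≤ ρ∕2`) and the END
   **`sqrt_l2sq_ErrIter_le_of_levelSmall : √l2sq_N (ErrIter L (j+1) W Y) ≤ ρ^{j+1}·√l2sq_{tower L N (j+1)} Y`**.

HONEST FRAMING.  Lattice kinematics on OUR frame: a displayed constant shrinks and one displayed smallness line becomes a consequence of the class; nothing
about Bałaban's minimisers; (P♮)_W, (ML_w) at W ≠ 1, T-E_w and NE3 are NOT proved; spine PROVED 0∕9; finite T⁴ rung (B)+1 — NOT infinite volume, NOT mass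
gap, NOT BetaPertH, NOT Clay.  ABSOLUTE RULE kept (no printed sentence is a hypothesis).  PLACEMENT: `Summits/QuantumFields/BalabanUV/`.
HONEST DEPENDENCY: continuum YM on T⁴ ⇐ BetaPertH ∧ nine spine estimates (0/9 proved); BetaPertH ⇐ (D1) ∧ (D4) ∧ CAP+tail; G-an2-4 gates asym, D1 and NE2/3/4.
-/

set_option autoImplicit false

open scoped BigOperators Matrix.Norms.L2Operator
open Finset

namespace Summit.QuantumFields.BalabanUV.T4Continuum.NE3CovariantLineSumsL2TowerSharp

open Literature.MathematicalPhysics.QuantumFieldTheory.Balaban1983to89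
open B7Prop1Explicit B7Prop2Explicit
open T4AveragingDeficitWall (IsUnitaryCfg SmallField)
open T4AveragingDeficitWallBoundary (IsPeriodicCfg periodBox)
open AveragingDeficitPeriodicCounting (IsPeriodicDir)
open AveragingDeficitChartCalculus (cavg)
open AveragingDeficitTwoLevelPrep (twoLevelSmall prop1Radius)
open AveragingDeficitMultiLevelPrep (tower LevelSmall radIter prop1Radius_nonneg)
open NE3TangentCovariantTower (QbarIter step_small)
open NE3CovariantLineSums (Qstr)
open NE3CovariantLineSumsTower (Dstr QstrIter ErrIter ErrIter_succ ErrIter_zero QbarIter_eq_QstrIter_add_ErrIter)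
open NE3CovariantLineSumsL2 (l2sq l2sq_nonneg sqrt_l2sq_add_le)
open NE3CovariantLineSumsL2Tower (rho rho_nonneg sqrt_l2sq_Qstr_le periodic_step sqrt_l2sq_QstrIter_le)
open NE3CovariantLineSumsL2Sharp (l2sq_Dstr_le_sharp)
open ReplicationRightInverseBound (radSum radSum_nonneg radSum_le twoLevelSmall_radIter)

noncomputable section

variable {d : ℕ} {n : Type*} [Fintype n] [DecidableEq n]

/-! ## §1 The one-level defect in the linear form `KS·a` -/

omit [Fintype n] [DecidableEq n] in
/-- `√(100080016·d²·L) ≤ 10004·d·L` (`L ≤ L²` for a natural `L`). [folklore] -/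
theorem sqrt_C2S_le (d L : ℕ) : Real.sqrt (100080016 * (d : ℝ) ^ 2 * L) ≤ 10004 * (d : ℝ) * L := by
  have hL : (L : ℝ) ≤ (L : ℝ) ^ 2 := by
    rcases Nat.eq_zero_or_pos L with h | h
    · subst h; simp
    · have : (1 : ℝ) ≤ L := by exact_mod_cast h
      nlinarith
  have h0 : 0 ≤ 10004 * (d : ℝ) * L := by positivity
  refine Real.sqrt_le_iff.mpr ⟨h0, ?_⟩
  have hd : 0 ≤ (d : ℝ) ^ 2 := sq_nonneg _
  nlinarith [mul_le_mul_of_nonneg_left hL hd]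

/-- **THE ONE-LEVEL DEFECT, LINEAR FORM**: `√l2sq_{N′} (Dstr L W Y) ≤ (160064·d·(d+1)·(d+4)·L³·a)·√l2sq_{L·N′} Y` in the one-level small-field class. [folklore] -/
theorem sqrt_l2sq_Dstr_le_sharp [Nonempty n] {L : ℕ} (hL : 1 ≤ L) {N' : ℕ} (hN' : 1 ≤ N') {W : Site d → Fin d → (Matrix n n ℂ)ˣ}
    (hWu : IsUnitaryCfg W) {a : ℝ} (ha : 0 ≤ a) (hsmall : 512 * (d + 1) * (d + 4) * (L : ℝ) ^ 2 * a ≤ 1) (hWa : SmallField W a)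
    {Y : Site d → Fin d → Matrix n n ℂ} (hY : IsPeriodicDir Y ((L * N' : ℕ) : ℤ)) :
    Real.sqrt (l2sq (periodBox (d := d) N') (Dstr L W Y))
      ≤ (160064 * (d : ℝ) * (d + 1) * (d + 4) * (L : ℝ) ^ 3 * a) * Real.sqrt (l2sq (periodBox (d := d) (L * N')) Y) := by
  have h := l2sq_Dstr_le_sharp hL hN' hWu ha hsmall hWa hY
  have hw0 : 0 ≤ 16 * (d + 1) * (d + 4) * (L : ℝ) ^ 2 * a := by positivity
  have hC0 : 0 ≤ 100080016 * (d : ℝ) ^ 2 * L := by positivity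
  have hS0 : 0 ≤ Real.sqrt (l2sq (periodBox (d := d) (L * N')) Y) := Real.sqrt_nonneg _
  calc Real.sqrt (l2sq (periodBox (d := d) N') (Dstr L W Y))
      ≤ Real.sqrt ((16 * (d + 1) * (d + 4) * (L : ℝ) ^ 2 * a) ^ 2 * (100080016 * (d : ℝ) ^ 2 * L) * l2sq (periodBox (d := d) (L * N')) Y) :=
        Real.sqrt_le_sqrt h
    _ = (16 * (d + 1) * (d + 4) * (L : ℝ) ^ 2 * a) * Real.sqrt (100080016 * (d : ℝ) ^ 2 * L)
          * Real.sqrt (l2sq (periodBox (d := d) (L * N')) Y) := by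
        rw [Real.sqrt_mul (by positivity), Real.sqrt_mul (by positivity), Real.sqrt_sq hw0]
    _ ≤ (16 * (d + 1) * (d + 4) * (L : ℝ) ^ 2 * a) * (10004 * (d : ℝ) * L) * Real.sqrt (l2sq (periodBox (d := d) (L * N')) Y) :=
        mul_le_mul_of_nonneg_right (mul_le_mul_of_nonneg_left (sqrt_C2S_le d L) hw0) hS0
    _ = (160064 * (d : ℝ) * (d + 1) * (d + 4) * (L : ℝ) ^ 3 * a) * Real.sqrt (l2sq (periodBox (d := d) (L * N')) Y) := by ring

/-! ## §2 The tower with the level sum `KS·radSum` -/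

omit [Fintype n] [DecidableEq n] in
/-- `radSum 0 x = x`. [folklore] -/
theorem radSum_zero' (d L : ℕ) (x : ℝ) : radSum d L 0 x = x := rfl

omit [Fintype n] [DecidableEq n] in
/-- `radSum (j+1) x = x + radSum j (prop1Radius x)`. [folklore] -/
theorem radSum_succ' (d L j : ℕ) (x : ℝ) : radSum d L (j + 1) x = x + radSum d L j (prop1Radius d L x) := rfl

/-- **THE k-LEVEL COMB ERROR IN ℓ²(TORUS), SHARP LEVEL SUM**: in the multi-level small-field class, for `W`, `Y` of period `tower L N (j+1)` and the
level sum `KS·radSum d L j x ≤ ρ∕2` (`KS = 160064·d·(d+1)·(d+4)·L³`):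
`√l2sq_{periodBox N} (ErrIter L (j+1) W Y) ≤ 2·(KS·radSum d L j x)·ρ^j·√l2sq_{periodBox (tower L N (j+1))} Y` — C1 file 5's induction verbatim. [folklore] -/
theorem sqrt_l2sq_ErrIter_le_sharp [Nonempty n] {L N : ℕ} (hL : 1 ≤ L) (hN : 1 ≤ N) (j : ℕ) :
    ∀ {W : Site d → Fin d → (Matrix n n ℂ)ˣ} {x : ℝ}, IsUnitaryCfg W → IsPeriodicCfg W ((tower L N (j + 1) : ℕ) : ℤ) → 0 ≤ x →
    LevelSmall d L j x → SmallField W x →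
    (160064 * (d : ℝ) * (d + 1) * (d + 4) * (L : ℝ) ^ 3) * radSum d L j x ≤ rho d L / 2 →
    ∀ {Y : Site d → Fin d → Matrix n n ℂ}, IsPeriodicDir Y ((tower L N (j + 1) : ℕ) : ℤ) →
      Real.sqrt (l2sq (periodBox (d := d) N) (ErrIter L (j + 1) W Y))
        ≤ 2 * ((160064 * (d : ℝ) * (d + 1) * (d + 4) * (L : ℝ) ^ 3) * radSum d L j x) * rho d L ^ j
            * Real.sqrt (l2sq (periodBox (d := d) (tower L N (j + 1))) Y) := by
  induction j with
  | zero =>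
      intro W x hWu hWP hx hsm hWx _ Y hYP
      obtain ⟨h512, -, -, -⟩ := step_small hL hWu hx hsm hWx
      obtain ⟨-, -, hYP'', -, -, -⟩ := periodic_step (d := d) hWP hYP
      have hE : ErrIter L (0 + 1) W Y = Dstr L W Y := by
        rw [zero_add, ErrIter_succ]; funext z κ; simp [ErrIter_zero, NE3TangentCovariantTower.QbarIter_zero]
      rw [hE]
      have h := sqrt_l2sq_Dstr_le_sharp hL hN hWu hx h512 hWx (N' := N) (by simpa [tower] using hYP'')
      rw [radSum_zero', pow_zero, mul_one]
      have hK0 : 0 ≤ 160064 * (d : ℝ) * (d + 1) * (d + 4) * (L : ℝ) ^ 3 * x := by positivity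
      have hq : 0 ≤ Real.sqrt (l2sq (periodBox (d := d) (tower L N (0 + 1))) Y) := Real.sqrt_nonneg _
      have h' : Real.sqrt (l2sq (periodBox (d := d) N) (Dstr L W Y))
          ≤ (160064 * (d : ℝ) * (d + 1) * (d + 4) * (L : ℝ) ^ 3 * x) * Real.sqrt (l2sq (periodBox (d := d) (tower L N (0 + 1))) Y) := by
        simpa [tower] using h
      nlinarith [mul_nonneg hK0 hq]
  | succ j ih =>
      intro W x hWu hWP hx hsm hWx hS Y hYP
      obtain ⟨h512, hW₁u, hr0, hW₁x⟩ := step_small hL hWu hx hsm.1 hWx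
      obtain ⟨-, -, hYP'', hW₁P, hQP, hDP⟩ := periodic_step (d := d) hWP hYP
      have hT1 : 1 ≤ tower L N (j + 1) := Nat.one_le_iff_ne_zero.mpr (by
        haveI : NeZero L := ⟨by omega⟩; haveI : NeZero N := ⟨by omega⟩
        exact AveragingDeficitMultiLevelPrep.tower_ne_zero L N (j + 1))
      -- the letter and the level sum split
      set KS : ℝ := 160064 * (d : ℝ) * (d + 1) * (d + 4) * (L : ℝ) ^ 3 with hKS
      have hKS0 : 0 ≤ KS := by rw [hKS]; positivity
      set S' : ℝ := KS * radSum d L j (prop1Radius d L x) with hS'def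
      have hSsplit : KS * radSum d L (j + 1) x = KS * x + S' := by rw [radSum_succ']; ring
      have hδ0 : 0 ≤ KS * x := mul_nonneg hKS0 hx
      have hS'0 : 0 ≤ S' := mul_nonneg hKS0 (radSum_nonneg (d := d) (L := L) j hr0)
      have hS'le : S' ≤ rho d L / 2 := by linarith
      have hρ := rho_nonneg d L
      -- names for the norms
      set nY : ℝ := Real.sqrt (l2sq (periodBox (d := d) (tower L N (j + 1 + 1))) Y) with hnY
      have hnY0 : 0 ≤ nY := Real.sqrt_nonneg _
      -- one-level bounds at the base
      have hQ : Real.sqrt (l2sq (periodBox (d := d) (tower L N (j + 1))) (Qstr L W Y)) ≤ rho d L * nY :=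
        sqrt_l2sq_Qstr_le hL hT1 hWu hx h512 hWx (N' := tower L N (j + 1)) hYP''
      have hD : Real.sqrt (l2sq (periodBox (d := d) (tower L N (j + 1))) (Dstr L W Y)) ≤ KS * x * nY :=
        sqrt_l2sq_Dstr_le_sharp hL hT1 hWu hx h512 hWx (N' := tower L N (j + 1)) hYP''
      -- first term: IH at W₁ on `Qstr W Y`
      have h1 := ih hW₁u hW₁P hr0 hsm.2 hW₁x hS'le hQP
      -- second term: `QbarIter = QstrIter + ErrIter` at W₁ on `Dstr W Y`, Minkowski
      have h2a := sqrt_l2sq_QstrIter_le hL hN j hW₁u hW₁P hr0 hsm.2 hW₁x hDP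
      have h2b := ih hW₁u hW₁P hr0 hsm.2 hW₁x hS'le hDP
      have h2 : Real.sqrt (l2sq (periodBox (d := d) N) (QbarIter L (j + 1) (cavg L W) (Dstr L W Y)))
          ≤ rho d L ^ (j + 1) * (KS * x * nY) + 2 * S' * rho d L ^ j * (KS * x * nY) := by
        rw [QbarIter_eq_QstrIter_add_ErrIter hL j hW₁u hr0 hsm.2 hW₁x (Dstr L W Y)]
        refine (sqrt_l2sq_add_le _ _ _).trans (add_le_add (h2a.trans ?_) (h2b.trans ?_))
        · exact mul_le_mul_of_nonneg_left hD (by positivity)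
        · exact mul_le_mul_of_nonneg_left hD (by positivity)
      have h1' : Real.sqrt (l2sq (periodBox (d := d) N) (ErrIter L (j + 1) (cavg L W) (Qstr L W Y)))
          ≤ 2 * S' * rho d L ^ j * (rho d L * nY) := h1.trans (mul_le_mul_of_nonneg_left hQ (by positivity))
      rw [ErrIter_succ, hSsplit]
      refine (sqrt_l2sq_add_le _ _ _).trans ((add_le_add h1' h2).trans ?_)
      -- `2S'ρ^j(ρ nY) + ρ^{j+1} δ nY + 2S'ρ^j δ nY ≤ 2(δ + S')ρ^{j+1} nY` iff `2S' ≤ ρ`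
      have hρj : (0 : ℝ) ≤ rho d L ^ j := by positivity
      have key : 2 * S' * rho d L ^ j * (KS * x * nY) ≤ rho d L ^ j * rho d L * (KS * x * nY) := by
        have : 2 * S' ≤ rho d L := by linarith
        nlinarith [mul_nonneg hρj (mul_nonneg hδ0 hnY0)]
      have e : rho d L ^ (j + 1) = rho d L ^ j * rho d L := pow_succ _ _
      rw [e]
      nlinarith [key, mul_nonneg hρj (mul_nonneg hδ0 hnY0), mul_nonneg hρj (mul_nonneg hρ hnY0), hS'0, hδ0]

/-! ## §3 The level-sum line is a theorem of the class -/

omit [Fintype n] [DecidableEq n] in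
/-- **THE LEVEL-SUM LINE FROM THE CLASS** (`L ≥ 2`): `LevelSmall d L j x`, `0 ≤ x` ⇒ `KS·radSum d L j x ≤ ρ∕2`, `KS = 160064·d·(d+1)·(d+4)·L³`
(`radSum ≤ (4∕3)·r_j`, `twoLevelSmall·r_j ≤ 1`, and `(8∕3)·KS ≤ twoLevelSmall·ρ` by `(d+1)(d+4) ≥ 4d`, `L^{d+4} ≥ 16`). [folklore] -/
theorem KS_radSum_le_half_rho {L : ℕ} (hL : 2 ≤ L) (j : ℕ) {x : ℝ} (hx : 0 ≤ x) (hs : LevelSmall d L j x) :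
    (160064 * (d : ℝ) * (d + 1) * (d + 4) * (L : ℝ) ^ 3) * radSum d L j x ≤ rho d L / 2 := by
  set KS : ℝ := 160064 * (d : ℝ) * (d + 1) * (d + 4) * (L : ℝ) ^ 3 with hKS
  have hKS0 : 0 ≤ KS := by rw [hKS]; positivity
  set r : ℝ := radIter d L j x with hr
  set tls : ℝ := twoLevelSmall d L with htls
  have htls0 : 0 < tls := by rw [htls]; unfold twoLevelSmall; positivity
  have htop : tls * r ≤ 1 := twoLevelSmall_radIter (d := d) (L := L) j hs
  have hsum : radSum d L j x ≤ 4 / 3 * r := by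
    have h := radSum_le (d := d) (L := L) hL j hx
    linarith
  -- reduce to `(8/3)·KS ≤ tls·ρ`
  have hL2 : (2 : ℝ) ≤ L := by exact_mod_cast hL
  have hL0 : (0 : ℝ) < L := by linarith
  have hd0 : (0 : ℝ) ≤ d := Nat.cast_nonneg d
  have hρ0 : 0 ≤ rho d L := rho_nonneg d L
  -- the squared numeric comparison `(64/9)·KS² ≤ tls²·(L²/L^d)`
  have hρ2 : rho d L ^ 2 = (L : ℝ) ^ 2 / (L : ℝ) ^ d := by
    unfold rho; rw [Real.sq_sqrt (by positivity)]
  have hnum : (64 / 9) * KS ^ 2 ≤ tls ^ 2 * ((L : ℝ) ^ 2 / (L : ℝ) ^ d) := by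
    have hLd : (0 : ℝ) < (L : ℝ) ^ d := by positivity
    rw [hKS, htls]
    unfold twoLevelSmall
    rw [← mul_div_assoc, le_div_iff₀ hLd]
    -- `(64/9)·160064²·d²(d+1)²(d+4)²·L⁶·L^d ≤ 65536²(d+1)⁴(d+4)⁴·L^{2d+8}·L²`
    have h14 : 4 * (d : ℝ) ≤ ((d : ℝ) + 1) * ((d : ℝ) + 4) := by nlinarith
    have h16 : (16 : ℝ) ≤ (L : ℝ) ^ (d + 4) := by
      calc (16 : ℝ) = 2 ^ 4 := by norm_num
        _ ≤ (L : ℝ) ^ 4 := pow_le_pow_left₀ (by norm_num) hL2 4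
        _ ≤ (L : ℝ) ^ (d + 4) := pow_le_pow_right₀ (by linarith) (by omega)
    have hA : 0 ≤ ((d : ℝ) + 1) * ((d : ℝ) + 4) := by positivity
    have hB : (0 : ℝ) ≤ (L : ℝ) ^ 6 * (L : ℝ) ^ d := by positivity
    -- rewrite the powers: `L^{d+4}·L^{d+4}·L² = L^{2d+10} = L^{d+4}·(L⁶·L^d)`
    have eR : (65536 * ((d : ℝ) + 1) ^ 2 * ((d : ℝ) + 4) ^ 2 * (L : ℝ) ^ (d + 4)) ^ 2 * (L : ℝ) ^ 2
        = 65536 ^ 2 * (((d : ℝ) + 1) * ((d : ℝ) + 4)) ^ 2 * (((d : ℝ) + 1) * ((d : ℝ) + 4)) ^ 2 * (L : ℝ) ^ (d + 4)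
          * ((L : ℝ) ^ 6 * (L : ℝ) ^ d) := by ring
    have eL : (64 / 9 : ℝ) * (160064 * (d : ℝ) * (d + 1) * (d + 4) * (L : ℝ) ^ 3) ^ 2 * (L : ℝ) ^ d
        = (64 / 9 * 160064 ^ 2) * ((d : ℝ) ^ 2 * (((d : ℝ) + 1) * ((d : ℝ) + 4)) ^ 2) * ((L : ℝ) ^ 6 * (L : ℝ) ^ d) := by ring
    rw [eL, eR]
    -- `(64/9)·160064²·d² ≤ 65536²·(4d)²·... ` via `16 d² ≤ ((d+1)(d+4))²` and `16 ≤ L^{d+4}`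
    have h14sq : 16 * (d : ℝ) ^ 2 ≤ (((d : ℝ) + 1) * ((d : ℝ) + 4)) ^ 2 := by nlinarith [h14, hA]
    have hX : 0 ≤ (((d : ℝ) + 1) * ((d : ℝ) + 4)) ^ 2 := sq_nonneg _
    calc (64 / 9 * 160064 ^ 2 : ℝ) * ((d : ℝ) ^ 2 * (((d : ℝ) + 1) * ((d : ℝ) + 4)) ^ 2) * ((L : ℝ) ^ 6 * (L : ℝ) ^ d)
        ≤ (65536 ^ 2 : ℝ) * ((((d : ℝ) + 1) * ((d : ℝ) + 4)) ^ 2 * (((d : ℝ) + 1) * ((d : ℝ) + 4)) ^ 2) * 16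
            * ((L : ℝ) ^ 6 * (L : ℝ) ^ d) := by
          refine mul_le_mul_of_nonneg_right ?_ hB
          nlinarith [mul_le_mul_of_nonneg_right h14sq hX]
      _ ≤ (65536 ^ 2 : ℝ) * ((((d : ℝ) + 1) * ((d : ℝ) + 4)) ^ 2 * (((d : ℝ) + 1) * ((d : ℝ) + 4)) ^ 2) * (L : ℝ) ^ (d + 4)
            * ((L : ℝ) ^ 6 * (L : ℝ) ^ d) := by
          refine mul_le_mul_of_nonneg_right (mul_le_mul_of_nonneg_left h16 (by positivity)) hB
      _ = _ := by ring
  -- from the squared comparison to `(8/3)·KS ≤ tls·ρ`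
  have hlin : (8 / 3) * KS ≤ tls * rho d L := by
    have h1 : ((8 / 3) * KS) ^ 2 ≤ (tls * rho d L) ^ 2 := by
      calc ((8 / 3) * KS) ^ 2 = (64 / 9) * KS ^ 2 := by ring
        _ ≤ tls ^ 2 * ((L : ℝ) ^ 2 / (L : ℝ) ^ d) := hnum
        _ = (tls * rho d L) ^ 2 := by rw [mul_pow, hρ2]
    exact (pow_le_pow_iff_left₀ (by positivity : (0:ℝ) ≤ 8 / 3 * KS) (mul_nonneg htls0.le hρ0) two_ne_zero).mp h1
  -- assemble: `KS·radSum ≤ KS·(4/3)·r ≤ (4/3)·KS/tls ≤ ρ/2`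
  have h2 : KS * radSum d L j x ≤ KS * (4 / 3 * r) := mul_le_mul_of_nonneg_left hsum hKS0
  have h3 : KS * (4 / 3 * r) * tls ≤ (4 / 3) * KS := by
    have : KS * (4 / 3 * r) * tls = (4 / 3) * KS * (tls * r) := by ring
    rw [this]
    nlinarith [htop, hKS0]
  -- `KS·(4/3)·r ≤ (4/3)·KS/tls ≤ (1/2)·ρ`
  have h4 : KS * (4 / 3 * r) ≤ rho d L / 2 := by
    rw [← mul_le_mul_iff_of_pos_right htls0]
    calc KS * (4 / 3 * r) * tls ≤ (4 / 3) * KS := h3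
      _ = (1 / 2) * ((8 / 3) * KS) := by ring
      _ ≤ (1 / 2) * (tls * rho d L) := mul_le_mul_of_nonneg_left hlin (by norm_num)
      _ = rho d L / 2 * tls := by ring
  exact h2.trans h4

/-- **THE k-LEVEL COMB ERROR IN ℓ²(TORUS) IN THE CLASS ALONE** (`L ≥ 2`): for unitary `W` and `Y` of period `tower L N (j+1)` with `0 ≤ x`, `LevelSmall d L j x`,
`SmallField W x`: `√l2sq_{periodBox N} (ErrIter L (j+1) W Y) ≤ ρ^{j+1}·√l2sq_{periodBox (tower L N (j+1))} Y` — NO level-sum hypothesis (it is discharged by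
`KS_radSum_le_half_rho`); the comb error tower carries the same weight as the straight tower `sqrt_l2sq_QstrIter_le`. [folklore] -/
theorem sqrt_l2sq_ErrIter_le_of_levelSmall [Nonempty n] {L N : ℕ} (hL : 2 ≤ L) (hN : 1 ≤ N) (j : ℕ)
    {W : Site d → Fin d → (Matrix n n ℂ)ˣ} {x : ℝ} (hWu : IsUnitaryCfg W) (hWP : IsPeriodicCfg W ((tower L N (j + 1) : ℕ) : ℤ)) (hx : 0 ≤ x)
    (hsm : LevelSmall d L j x) (hWx : SmallField W x) {Y : Site d → Fin d → Matrix n n ℂ} (hYP : IsPeriodicDir Y ((tower L N (j + 1) : ℕ) : ℤ)) :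
    Real.sqrt (l2sq (periodBox (d := d) N) (ErrIter L (j + 1) W Y))
      ≤ rho d L ^ (j + 1) * Real.sqrt (l2sq (periodBox (d := d) (tower L N (j + 1))) Y) := by
  have hL1 : 1 ≤ L := by omega
  have hS := KS_radSum_le_half_rho (d := d) hL j hx hsm
  have h := sqrt_l2sq_ErrIter_le_sharp (d := d) hL1 hN j hWu hWP hx hsm hWx hS hYP
  have hρ := rho_nonneg d L
  have hq : 0 ≤ Real.sqrt (l2sq (periodBox (d := d) (tower L N (j + 1))) Y) := Real.sqrt_nonneg _
  have hK0 : 0 ≤ (160064 * (d : ℝ) * (d + 1) * (d + 4) * (L : ℝ) ^ 3) * radSum d L j x :=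
    mul_nonneg (by positivity) (radSum_nonneg (d := d) (L := L) j hx)
  have hρj : (0 : ℝ) ≤ rho d L ^ j := by positivity
  calc Real.sqrt (l2sq (periodBox (d := d) N) (ErrIter L (j + 1) W Y))
      ≤ 2 * ((160064 * (d : ℝ) * (d + 1) * (d + 4) * (L : ℝ) ^ 3) * radSum d L j x) * rho d L ^ j
          * Real.sqrt (l2sq (periodBox (d := d) (tower L N (j + 1))) Y) := h
    _ ≤ rho d L * rho d L ^ j * Real.sqrt (l2sq (periodBox (d := d) (tower L N (j + 1))) Y) := by
        have : 2 * ((160064 * (d : ℝ) * (d + 1) * (d + 4) * (L : ℝ) ^ 3) * radSum d L j x) ≤ rho d L := by linarith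
        exact mul_le_mul_of_nonneg_right (mul_le_mul_of_nonneg_right this hρj) hq
    _ = rho d L ^ (j + 1) * Real.sqrt (l2sq (periodBox (d := d) (tower L N (j + 1))) Y) := by rw [pow_succ]; ring

end

end Summit.QuantumFields.BalabanUV.T4Continuum.NE3CovariantLineSumsL2TowerSharp
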